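import Mathlib

/-!
# Solo-blind seat (MatrixMultiplication), s77 — the HALL / distinct-label form of the layer bound `L(k)` fails at `k = 4`
(paper/KraftK3.md §7.19, CLAIMS c810–c814)

Background (door I1⁗, the Kraft inequality (K₃) for zero-sum-free sequences over `𝔽₃`, see `SoloBlindKraftDecomposition`,
`SoloBlindOlsonBerman`): for a zero-sum-free `h : [n] → 𝔽₃^r` and a target `τ`, the per-layer form `L(k)` of (K₃) asserts that
at most `2^k` subsets `T` of size `k` have `∑_{i ∈ T} h i = τ` (a theorem for `k ≤ 4` in every rank, by complete censuses; open
for `k ≥ 5`).  A natural strengthening that would make `L(k)` inductive is the DISTINCT-LABEL (Hall) form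

  `DS(k)`: for every size-`k` representation `T₀` of `τ` there is an INJECTIVE labelling `ι` of the size-`k` representations by
  subsets of `T₀` with `ι(T) ⊆ T₀ \ T`

(labels avoid the labelled set; `DS(k) ⇒ L(k)` because `T₀` has `2^k` subsets; the principal Hall conditions of `DS` are exactly
the bounds `L(j)`, `j ≤ k`, on sub-sequences).  `DS(k)` holds for `k ≤ 3` in every rank (census of the 104 closed admissible
3-generated families) and for every `k` in rank `≤ 4` (exhaustive), but this file certifies in the kernel that **`DS(4)` is
false in rank 5**: for the explicit zero-sum-free `soloBlindHO_h : Fin 10 → 𝔽₃⁵` (length `10 = 2·5`, the maximal length) and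
`τ = (1,0,1,1,1)` the size-4 representations of `τ` are exactly the 13 sets `soloBlindHO_member j`; all of them meet the twin
pair `{0, 2}` (`h 0 = h 2`), which lies inside the representation `T₀ = {0,1,2,3}`; hence every admissible label `ι(T) ⊆ T₀ \ T`
misses `0` or `2`, only `2^4 - 2^2 = 12 < 13` such labels exist, and no injective labelling exists (pigeonhole).  The numerology
is `deg 0 + deg 2 - codeg = 7 + 7 - 1 = 13 > 12`: a near-exact pair cover through `T₀`.  Pure finite combinatorics; no `ω` content.

The finite checks (`2^10` subsets for zero-sum freeness and for the fibre, `13 · 2^10` label inclusions) are `decide +kernel`.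
-/

set_option linter.dupNamespace false
set_option autoImplicit false

namespace Summit.MatrixMultiplication.MatrixMultiplication.Theorems

open Finset BigOperators

/-- The group `𝔽₃⁵`, as a nested product (computation-friendly for `decide`). -/
abbrev SoloBlindG5 : Type := ZMod 3 × ZMod 3 × ZMod 3 × ZMod 3 × ZMod 3

/-- The explicit zero-sum-free sequence of length 10 in `𝔽₃⁵` (rank 5, maximal length; twins `h 0 = h 2`, `h 5 = h 7`, `h 6 = h 9`). -/
def soloBlindHO_h : Fin 10 → SoloBlindG5 :=
  ![(1, 0, 0, 0, 0), (0, 1, 0, 0, 0), (1, 0, 0, 0, 0), (2, 2, 1, 1, 1), (0, 0, 1, 0, 0),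
    (0, 0, 0, 1, 0), (0, 0, 0, 0, 1), (0, 0, 0, 1, 0), (0, 2, 1, 0, 1), (0, 0, 0, 0, 1)]

/-- The target `τ = e₁ + e₃ + e₄ + e₅`. -/
def soloBlindHO_tau : SoloBlindG5 := (1, 0, 1, 1, 1)

/-- The 13 size-4 representations of `τ` (this is the whole fibre of `τ`: no representation of another size exists). -/
def soloBlindHO_member : Fin 13 → Finset (Fin 10) :=
  ![{0, 1, 2, 3}, {0, 1, 5, 8}, {0, 1, 7, 8}, {0, 4, 5, 6}, {0, 4, 5, 9}, {0, 4, 6, 7}, {0, 4, 7, 9},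
    {1, 2, 5, 8}, {1, 2, 7, 8}, {2, 4, 5, 6}, {2, 4, 5, 9}, {2, 4, 6, 7}, {2, 4, 7, 9}]

/-- The base representation `T₀ = {0,1,2,3}` (it contains the twin pair `{0,2}`). -/
def soloBlindHO_T0 : Finset (Fin 10) := {0, 1, 2, 3}

/-- The admissible labels that miss `0` or `2`: subsets of `T₀` not containing the pair `{0,2}`. -/
def soloBlindHO_labels : Finset (Finset (Fin 10)) :=
  soloBlindHO_T0.powerset.filter (fun L => ¬ ({0, 2} : Finset (Fin 10)) ⊆ L)

set_option maxHeartbeats 0 in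
/-- ZERO-SUM FREE: the only subset of `soloBlindHO_h` summing to zero is the empty one (all `2^10` subsets, in the kernel). -/
theorem soloBlindHO_zsf : ∀ T : Finset (Fin 10), ∑ i ∈ T, soloBlindHO_h i = 0 → T = ∅ := by
  decide +kernel

set_option maxHeartbeats 0 in
/-- THE FIBRE: a subset of the sequence sums to `τ` iff it is one of the 13 listed size-4 sets. -/
theorem soloBlindHO_fibre : ∀ T : Finset (Fin 10),
    (∑ i ∈ T, soloBlindHO_h i = soloBlindHO_tau) ↔ T ∈ (univ : Finset (Fin 13)).image soloBlindHO_member := by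
  decide +kernel

/-- The 13 listed sets are pairwise distinct. -/
theorem soloBlindHO_member_injective : Function.Injective soloBlindHO_member := by
  decide +kernel

/-- There are exactly 13 representations of `τ`, all of size 4, all meeting the pair `{0,2}`, and `T₀` is one of them. -/
theorem soloBlindHO_fibre_facts :
    ((univ : Finset (Fin 13)).image soloBlindHO_member).card = 13 ∧
    (∀ j : Fin 13, (soloBlindHO_member j).card = 4 ∧ (0 ∈ soloBlindHO_member j ∨ 2 ∈ soloBlindHO_member j)) ∧
    soloBlindHO_member 0 = soloBlindHO_T0 ∧ soloBlindHO_h 0 = soloBlindHO_h 2 := by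
  refine ⟨?_, by decide, by decide, by decide⟩
  rw [card_image_of_injective _ soloBlindHO_member_injective, card_univ, Fintype.card_fin]

/-- Only `12 = 2^4 - 2^2` subsets of `T₀` miss `0` or `2`. -/
theorem soloBlindHO_labels_card : soloBlindHO_labels.card = 12 := by
  decide

set_option maxHeartbeats 0 in
/-- Every label allowed for the `j`-th representation (a subset of `T₀` disjoint from it) misses `0` or `2`. -/
theorem soloBlindHO_label_mem : ∀ j : Fin 13, ∀ L : Finset (Fin 10),
    L ⊆ soloBlindHO_T0 \ soloBlindHO_member j → L ∈ soloBlindHO_labels := by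
  decide +kernel

/-- HALL OBSTRUCTION (CLAIMS c811): there is no injective labelling of the 13 representations by subsets of `T₀` avoiding the
labelled set — the distinct-label form `DS(4)` of the layer bound fails for this (rank-5, maximal-length) zero-sum-free sequence,
although `L(4)` itself holds (`13 ≤ 16`). -/
theorem soloBlindHO_no_injective_labelling (ι : Fin 13 → Finset (Fin 10))
    (hι : ∀ j, ι j ⊆ soloBlindHO_T0 \ soloBlindHO_member j) : ¬ Function.Injective ι := by
  intro hinj
  have hsub : (univ : Finset (Fin 13)).image ι ⊆ soloBlindHO_labels := by
    intro L hL
    obtain ⟨j, -, rfl⟩ := mem_image.mp hL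
    exact soloBlindHO_label_mem j (ι j) (hι j)
  have h1 := card_le_card hsub
  rw [card_image_of_injective _ hinj, card_univ, Fintype.card_fin, soloBlindHO_labels_card] at h1
  omega

/-- SUMMARY (CLAIMS c810–c811): an explicit zero-sum-free `h : Fin 10 → 𝔽₃⁵`, a target `τ` and a size-4 representation `T₀` of `τ`
such that the size-4 representations of `τ` — 13 of them — admit no injective labelling `ι` with `ι(T) ⊆ T₀ \ T`. -/
theorem soloBlind_hall_form_fails :
    ∃ (h : Fin 10 → SoloBlindG5) (τ : SoloBlindG5) (T₀ : Finset (Fin 10)) (M : Fin 13 → Finset (Fin 10)),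
      (∀ T : Finset (Fin 10), ∑ i ∈ T, h i = 0 → T = ∅) ∧
      (∑ i ∈ T₀, h i = τ) ∧ T₀.card = 4 ∧ Function.Injective M ∧
      (∀ j, (M j).card = 4 ∧ ∑ i ∈ M j, h i = τ) ∧
      (∀ ι : Fin 13 → Finset (Fin 10), (∀ j, ι j ⊆ T₀ \ M j) → ¬ Function.Injective ι) :=
  ⟨soloBlindHO_h, soloBlindHO_tau, soloBlindHO_T0, soloBlindHO_member, soloBlindHO_zsf, by decide, by decide,
    soloBlindHO_member_injective,
    fun j => ⟨(soloBlindHO_fibre_facts.2.1 j).1, (soloBlindHO_fibre (soloBlindHO_member j)).mpr (mem_image_of_mem _ (mem_univ j))⟩,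
    soloBlindHO_no_injective_labelling⟩

end Summit.MatrixMultiplication.MatrixMultiplication.Theorems
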